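import Summits.CriticalPhenomena.Ising3DConformalLimit.Theorems.MonotoneBlockingMonotoneBlockingTwoKarlinDefs
import HarnessLib

/-!
# Stub `foldedTent_tp2` of line `Sketch` (karlin-scale-tp2) for crux `MonotoneBlockingTwo` (stmt-CriticalPhenomena-17054)

The folded unit tent `S(t,n) = T(t − n) + T(t + n)` (`T(u) = (1 − |u|)₊`) is TP₂ (log-supermodular) on
`[0,∞) × ℕ`:
`S(t,n) S(t',n') ≤ S(t ∨ t', n ∨ n') S(t ∧ t', n ∧ n')`.

Proof. For `t ≥ 0` and `n ≥ 1` the second summand vanishes (`t + n ≥ 1`), so `S(t,n) = c(n) · T(t − n)` with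
`c(0) = 2`, `c(n) = 1` (`n ≥ 1`); hence TP₂ of `S` reduces to the log-concavity of the tent in product form:
for `a ≤ a' ≤ b`, `a ≤ b' ≤ b`, `a' + b' = a + b` one has `T(a) T(b) ≤ T(a') T(b')`. The latter is proved without
division: with `p = b − a'`, `q = a' − a`, `D = p + q = b − a`, the triangle inequality gives
`D (1 − |a'|) ≥ p (1 − |a|) + q (1 − |b|)` and `D (1 − |b'|) ≥ q (1 − |a|) + p (1 − |b|)`, and
`(pA + qB)(qA + pB) = D² AB + pq (A − B)² ≥ D² AB`.
-/

noncomputable section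

namespace Summit.CriticalPhenomena.Ising3DConformalLimit.Cruxes.MonotoneBlockingTwo.KarlinScaleTP2

/-! ## Elementary facts about the unit tent -/

/-- For `t ≥ 0` and an integer `n ≥ 1` the shifted tent `T(t + n)` vanishes (`t + n ≥ 1`). -/
theorem tent_add_nat_eq_zero {t : ℝ} (ht : 0 ≤ t) {n : ℕ} (hn : 0 < n) : tent (t + n) = 0 := by
  have h1 : (1 : ℝ) ≤ n := by exact_mod_cast hn
  have habs : |t + n| = t + n := abs_of_nonneg (by positivity)
  rw [tent, habs]
  exact max_eq_left (by linarith)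

/-- Log-concavity of `u ↦ 1 - |u|` on `[-1, 1]` in product (division-free) form: if `a ≤ a' ≤ b`,
`a ≤ b' ≤ b` and `a' + b' = a + b`, then `(1 - |a|)(1 - |b|) ≤ (1 - |a'|)(1 - |b'|)`. -/
theorem one_sub_abs_mul_le {a a' b' b : ℝ} (h1 : a ≤ a') (h2 : a' ≤ b) (h3 : a ≤ b') (h4 : b' ≤ b)
    (hs : a' + b' = a + b) (ha : |a| ≤ 1) (hb : |b| ≤ 1) :
    (1 - |a|) * (1 - |b|) ≤ (1 - |a'|) * (1 - |b'|) := by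
  rcases eq_or_lt_of_le (le_trans h1 h2) with hab | hab
  · -- degenerate interval: `a = b`, hence `a' = a` and `b' = b`
    have ha' : a' = a := le_antisymm (hab ▸ h2) h1
    have hb' : b' = b := le_antisymm h4 (hab ▸ h3)
    rw [ha', hb']
  · have hD : 0 < b - a := sub_pos.2 hab
    have hp : 0 ≤ b - a' := sub_nonneg.2 h2
    have hq : 0 ≤ a' - a := sub_nonneg.2 h1
    have hA : 0 ≤ 1 - |a| := sub_nonneg.2 ha
    have hB : 0 ≤ 1 - |b| := sub_nonneg.2 hb
    -- `a'` and `b'` as (unnormalised) convex combinations of `a` and `b`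
    have e1 : (b - a) * a' = (b - a') * a + (a' - a) * b := by ring
    have e2 : (b - a) * b' = (a' - a) * a + (b - a') * b := by
      have hb' : b' = a + b - a' := by linarith
      rw [hb']
      ring
    -- triangle inequality
    have t1 : (b - a) * |a'| ≤ (b - a') * |a| + (a' - a) * |b| := by
      calc (b - a) * |a'| = |(b - a') * a + (a' - a) * b| := by
            rw [← e1, abs_mul, abs_of_pos hD]
        _ ≤ |(b - a') * a| + |(a' - a) * b| := abs_add_le _ _
        _ = (b - a') * |a| + (a' - a) * |b| := by
            rw [abs_mul, abs_mul, abs_of_nonneg hp, abs_of_nonneg hq]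
    have t2 : (b - a) * |b'| ≤ (a' - a) * |a| + (b - a') * |b| := by
      calc (b - a) * |b'| = |(a' - a) * a + (b - a') * b| := by
            rw [← e2, abs_mul, abs_of_pos hD]
        _ ≤ |(a' - a) * a| + |(b - a') * b| := abs_add_le _ _
        _ = (a' - a) * |a| + (b - a') * |b| := by
            rw [abs_mul, abs_mul, abs_of_nonneg hq, abs_of_nonneg hp]
    -- concavity lower bounds for the two factors on the right
    have l1 : (b - a') * (1 - |a|) + (a' - a) * (1 - |b|) ≤ (b - a) * (1 - |a'|) := by linarith
    have l2 : (a' - a) * (1 - |a|) + (b - a') * (1 - |b|) ≤ (b - a) * (1 - |b'|) := by linarith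
    have n1 : 0 ≤ (b - a') * (1 - |a|) + (a' - a) * (1 - |b|) :=
      add_nonneg (mul_nonneg hp hA) (mul_nonneg hq hB)
    have n2 : 0 ≤ (a' - a) * (1 - |a|) + (b - a') * (1 - |b|) :=
      add_nonneg (mul_nonneg hq hA) (mul_nonneg hp hB)
    have key : (b - a) ^ 2 * ((1 - |a|) * (1 - |b|)) ≤ (b - a) ^ 2 * ((1 - |a'|) * (1 - |b'|)) := by
      calc (b - a) ^ 2 * ((1 - |a|) * (1 - |b|))
          ≤ ((b - a') * (1 - |a|) + (a' - a) * (1 - |b|)) *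
              ((a' - a) * (1 - |a|) + (b - a') * (1 - |b|)) := by
            have hid : ((b - a') * (1 - |a|) + (a' - a) * (1 - |b|)) *
                ((a' - a) * (1 - |a|) + (b - a') * (1 - |b|)) =
                (b - a) ^ 2 * ((1 - |a|) * (1 - |b|)) +
                  (b - a') * (a' - a) * ((1 - |a|) - (1 - |b|)) ^ 2 := by ring
            rw [hid]
            have hr : 0 ≤ (b - a') * (a' - a) * ((1 - |a|) - (1 - |b|)) ^ 2 :=
              mul_nonneg (mul_nonneg hp hq) (sq_nonneg _)
            linarith
        _ ≤ ((b - a) * (1 - |a'|)) * ((b - a) * (1 - |b'|)) := mul_le_mul l1 l2 n2 (n1.trans l1)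
        _ = (b - a) ^ 2 * ((1 - |a'|) * (1 - |b'|)) := by ring
    exact le_of_mul_le_mul_left key (by positivity)

/-- Log-concavity of the tent in product form: if `a ≤ a' ≤ b`, `a ≤ b' ≤ b` and `a' + b' = a + b`, then
`T(a) T(b) ≤ T(a') T(b')`. -/
theorem tent_mul_tent_le {a a' b' b : ℝ} (h1 : a ≤ a') (h2 : a' ≤ b) (h3 : a ≤ b') (h4 : b' ≤ b)
    (hs : a' + b' = a + b) : tent a * tent b ≤ tent a' * tent b' := by
  -- the tent is non-negative, vanishes outside `(-1, 1)` and equals `1 - |u|` on `[-1, 1]`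
  have hnn : ∀ u : ℝ, 0 ≤ tent u := fun u => le_max_left _ _
  have hzero : ∀ u : ℝ, 1 ≤ |u| → tent u = 0 := fun u hu => max_eq_left (by linarith)
  have heq : ∀ u : ℝ, |u| ≤ 1 → tent u = 1 - |u| := fun u hu => max_eq_right (by linarith)
  rcases le_or_gt 1 |a| with ha | ha
  · rw [hzero a ha, zero_mul]
    exact mul_nonneg (hnn _) (hnn _)
  rcases le_or_gt 1 |b| with hb | hb
  · rw [hzero b hb, mul_zero]
    exact mul_nonneg (hnn _) (hnn _)
  have ha2 := abs_lt.1 ha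
  have hb2 := abs_lt.1 hb
  have ha' : |a'| ≤ 1 := abs_le.2 ⟨by linarith, by linarith⟩
  have hb' : |b'| ≤ 1 := abs_le.2 ⟨by linarith, by linarith⟩
  rw [heq a ha.le, heq b hb.le, heq a' ha', heq b' hb']
  exact one_sub_abs_mul_le h1 h2 h3 h4 hs ha.le hb.le

/-! ## The folded tent on `[0, ∞)` -/

/-- On `t ≥ 0` the folded tent is a non-negative multiple of a translate of the tent:
`S(t,n) = c(n) · T(t − n)` with `c(0) = 2` and `c(n) = 1` for `n ≥ 1`. -/
theorem foldedTent_factor (n : ℕ) :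
    ∃ c : ℝ, 0 ≤ c ∧ ∀ t : ℝ, 0 ≤ t → foldedTent t n = c * tent (t - n) := by
  rcases Nat.eq_zero_or_pos n with rfl | hn
  · refine ⟨2, by norm_num, fun t _ => ?_⟩
    rw [foldedTent, Nat.cast_zero, sub_zero, add_zero, two_mul]
  · refine ⟨1, zero_le_one, fun t ht => ?_⟩
    rw [foldedTent, tent_add_nat_eq_zero ht hn, add_zero, one_mul]

/-- The crossing case of TP₂: for `0 ≤ t ≤ t'` and `n' ≤ n`,
`S(t,n) S(t',n') ≤ S(t',n) S(t,n')`. -/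
theorem foldedTent_cross {t t' : ℝ} {n n' : ℕ} (ht : 0 ≤ t) (ht' : 0 ≤ t') (htt : t ≤ t')
    (hnn : n' ≤ n) :
    foldedTent t n * foldedTent t' n' ≤ foldedTent t' n * foldedTent t n' := by
  obtain ⟨c, hc, hcf⟩ := foldedTent_factor n
  obtain ⟨c', hc', hcf'⟩ := foldedTent_factor n'
  rw [hcf t ht, hcf t' ht', hcf' t' ht', hcf' t ht]
  have hcast : (n' : ℝ) ≤ n := Nat.cast_le.2 hnn
  have key : tent (t - n) * tent (t' - n') ≤ tent (t' - n) * tent (t - n') :=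
    tent_mul_tent_le (a := t - n) (a' := t' - n) (b' := t - n') (b := t' - n')
      (by linarith) (by linarith) (by linarith) (by linarith) (by ring)
  calc c * tent (t - n) * (c' * tent (t' - n'))
      = (c * c') * (tent (t - n) * tent (t' - n')) := by ring
    _ ≤ (c * c') * (tent (t' - n) * tent (t - n')) :=
        mul_le_mul_of_nonneg_left key (mul_nonneg hc hc')
    _ = c * tent (t' - n) * (c' * tent (t - n')) := by ring

/-! ## The stub -/

/-- **Stub `foldedTent_tp2`**: the folded unit tent `S(t,n) = T(t − n) + T(t + n)` is TP₂ on `[0,∞) × ℕ`,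
`S(t,n) S(t',n') ≤ S(t ∨ t', n ∨ n') S(t ∧ t', n ∧ n')`. -/
theorem stub_foldedTent_tp2 : Sig.stub_foldedTent_tp2 := by
  intro t t' n n' ht ht'
  rcases le_total t t' with htt | htt <;> rcases le_total n n' with hnn | hnn
  · -- comparable: `(t,n) ≤ (t',n')`
    rw [max_eq_right htt, max_eq_right hnn, min_eq_left htt, min_eq_left hnn, mul_comm]
  · -- crossing: `t ≤ t'`, `n' ≤ n`
    rw [max_eq_right htt, max_eq_left hnn, min_eq_left htt, min_eq_right hnn]
    exact foldedTent_cross ht ht' htt hnn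
  · -- crossing: `t' ≤ t`, `n ≤ n'`
    rw [max_eq_left htt, max_eq_right hnn, min_eq_right htt, min_eq_left hnn, mul_comm]
    exact foldedTent_cross ht' ht htt hnn
  · -- comparable: `(t',n') ≤ (t,n)`
    rw [max_eq_left htt, max_eq_left hnn, min_eq_right htt, min_eq_right hnn]

end Summit.CriticalPhenomena.Ising3DConformalLimit.Cruxes.MonotoneBlockingTwo.KarlinScaleTP2

end
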